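import Literature.AlgebraicGeometry.Resolution.QuadraticTransforms
import Mathlib.RingTheory.Valuation.LocalSubring
import HarnessLib

/-!
# Realisation of infinite blow-up branches by valuations (Chevalley on a dominated chain)

Summit-side support lemma for the valuation-driven phases of the `e = 1` analysis
(solo/informed, theorem-W §9.2(e), "Lemma R"): an infinite sequence of LOCAL blow-ups
`(B₀,x₀) ← (B₁,x₁) ← ⋯` of integral local schemes with a common function field `K` is, on the
level of local rings, a chain of local subrings `O₀ ≤ O₁ ≤ ⋯` of `K`, each DOMINATED by the next
(`m_{i+1} ∩ O_i = m_i`, because `x_{i+1} ↦ x_i`). The union of such a chain is again a local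
subring dominating every member, and Chevalley's extension theorem
(Mathlib `LocalSubring.exists_le_valuationSubring`) produces a valuation ring `W` of `K`
dominating the union, hence every `O_i`: the branch is the branch of CENTRES of the valuation
`W` (the centre of `W` on the separated scheme `Bl B_i` is the unique point whose local ring `W`
dominates). Consequently a blow-up STRATEGY that terminates along every valuation of `K`
terminates along every rule choosing successive points — the form in which Cossart–Piltant's
valuation-theoretic local uniformisation theorems (arXiv:1412.0868 Thm. 1.4 / Def. 2.18
"independent sequences"; RACSAM 108 (2014) Main Thm. 0.3) are consumed when the driving
valuation lives on a LARGER field (theorem-W §9.2, Lemma A).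

* `isLocalRing_iSup_of_dominated_chain` — the union `⨆ i, R i` of a chain of local subrings of a
  field, each dominated by the next, is a local ring;
* `subringDominates_iSup_of_dominated_chain` — it dominates every member;
* `exists_valuationSubring_dominates_chain` — **Lemma R**: some valuation subring of `K`
  dominates every member of the chain;
* `exists_valuationSubring_le_chain` — the same in Mathlib's domination order on
  `LocalSubring K`;
* `not_forall_valuationSubring_exists_not_dominates` — contrapositive ("no infinite branch
  escapes every valuation").

No new definitions; `SubringDominates` is `Literature/…/QuadraticTransforms.lean`'s
(Cutkosky's `m_S ∩ R = m_R`, = Mathlib's order on `LocalSubring`, `subringDominates_iff`).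
The integrally-closed, residually-transcendental refinement (Abhyankar 1956, Lemma 7) is
`Literature/…/DominatedUnions.lean`; the plain statement here has no integral-closedness
hypothesis and is what the `e = 1` blow-up towers (whose local rings are not normal) need.
-/

noncomputable section

namespace Summit.ResolutionOfSingularities.ResolutionOfSingularities.Theorems

open IsLocalRing Literature.AlgebraicGeometry.Resolution

universe u

variable {K : Type u} [Field K]

/-- In a chain of subrings each dominated by the next, every later member dominates every
earlier one. -/
theorem subringDominates_of_le_of_dominated_chain (R : ℕ → Subring K)
    (hdom : ∀ i, SubringDominates (R i) (R (i + 1))) {i j : ℕ} (hij : i ≤ j) :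
    SubringDominates (R i) (R j) := by
  induction hij with
  | refl => exact SubringDominates.refl _
  | step _ ih => exact ih.trans (hdom _)

/-- The union of a chain of subrings of a field, each dominated by the next, is their directed
supremum: membership is membership in some member. -/
theorem mem_iSup_of_dominated_chain (R : ℕ → Subring K)
    (hdom : ∀ i, SubringDominates (R i) (R (i + 1))) (x : K) :
    x ∈ (⨆ i, R i) ↔ ∃ i, x ∈ R i :=
  Subring.mem_iSup_of_directed (monotone_nat_of_le_succ fun i => (hdom i).1).directed_le

/-- An inverse found in the union is already found in every member containing the element. -/
theorem inv_mem_of_dominated_chain (R : ℕ → Subring K)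
    (hdom : ∀ i, SubringDominates (R i) (R (i + 1))) (i : ℕ) {x : K} (hx : x ∈ R i)
    (hxU : x⁻¹ ∈ (⨆ i, R i)) : x⁻¹ ∈ R i := by
  have hmono : Monotone R := monotone_nat_of_le_succ fun i => (hdom i).1
  obtain ⟨j, hj⟩ := (mem_iSup_of_dominated_chain R hdom _).mp hxU
  exact (subringDominates_of_le_of_dominated_chain R hdom (le_max_left i j)).2 x hx
    (hmono (le_max_right i j) hj)

/-- **The union of a dominated chain of local subrings is local.** -/
theorem isLocalRing_iSup_of_dominated_chain (R : ℕ → Subring K)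
    (hloc : ∀ i, IsLocalRing (R i)) (hdom : ∀ i, SubringDominates (R i) (R (i + 1))) :
    IsLocalRing (⨆ i, R i : Subring K) := by
  classical
  have hmono : Monotone R := monotone_nat_of_le_succ fun i => (hdom i).1
  set U : Subring K := ⨆ i, R i with hU
  have hmemU : ∀ x, x ∈ U ↔ ∃ i, x ∈ R i := mem_iSup_of_dominated_chain R hdom
  have hRU : ∀ i, R i ≤ U := fun i => le_iSup R i
  refine IsLocalRing.of_nonunits_add ?_
  intro a b ha hb
  rw [mem_nonunits_iff] at ha hb ⊢
  intro hab
  obtain ⟨hab0, habinv⟩ := (isUnit_subring_iff_inv_mem _).mp hab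
  obtain ⟨i, hi⟩ := (hmemU _).mp a.2
  obtain ⟨j, hj⟩ := (hmemU _).mp b.2
  set k := max i j
  have hak : (a : K) ∈ R k := hmono (le_max_left i j) hi
  have hbk : (b : K) ∈ R k := hmono (le_max_right i j) hj
  haveI := hloc k
  have habk : IsUnit (⟨(a : K) + b, (R k).add_mem hak hbk⟩ : R k) := by
    rw [isUnit_subring_iff_inv_mem]
    exact ⟨hab0, inv_mem_of_dominated_chain R hdom k ((R k).add_mem hak hbk) habinv⟩
  have habk' : (⟨(a : K) + b, (R k).add_mem hak hbk⟩ : R k) = ⟨a, hak⟩ + ⟨b, hbk⟩ := rfl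
  rw [habk'] at habk
  rcases IsLocalRing.isUnit_or_isUnit_of_isUnit_add habk with hu | hu
  · obtain ⟨h0, hinv⟩ := (isUnit_subring_iff_inv_mem _).mp hu
    exact ha ((isUnit_subring_iff_inv_mem _).mpr ⟨h0, hRU k hinv⟩)
  · obtain ⟨h0, hinv⟩ := (isUnit_subring_iff_inv_mem _).mp hu
    exact hb ((isUnit_subring_iff_inv_mem _).mpr ⟨h0, hRU k hinv⟩)

/-- **The union dominates every member of the chain.** -/
theorem subringDominates_iSup_of_dominated_chain (R : ℕ → Subring K)
    (hdom : ∀ i, SubringDominates (R i) (R (i + 1))) (i : ℕ) :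
    SubringDominates (R i) (⨆ i, R i) :=
  ⟨le_iSup R i, fun _ hx hxU => inv_mem_of_dominated_chain R hdom i hx hxU⟩

/-- **Lemma R (realisation of an infinite branch by a valuation).** For a chain
`R₀ ≤ R₁ ≤ ⋯` of local subrings of a field `K`, each dominated by the next, some valuation
subring of `K` dominates every `R i` (Chevalley applied to the local ring `⋃ R i`). -/
theorem exists_valuationSubring_dominates_chain (R : ℕ → Subring K)
    (hloc : ∀ i, IsLocalRing (R i)) (hdom : ∀ i, SubringDominates (R i) (R (i + 1))) :
    ∃ W : ValuationSubring K, ∀ i, SubringDominates (R i) W.toSubring := by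
  haveI hUloc : IsLocalRing (⨆ i, R i : Subring K) :=
    isLocalRing_iSup_of_dominated_chain R hloc hdom
  obtain ⟨W, hW⟩ := (LocalSubring.mk (⨆ i, R i)).exists_le_valuationSubring
  haveI : IsLocalRing W.toSubring := W.toLocalSubring.isLocalRing
  have hUW : SubringDominates (⨆ i, R i) W.toSubring := (subringDominates_iff _ _).mpr hW
  exact ⟨W, fun i => (subringDominates_iSup_of_dominated_chain R hdom i).trans hUW⟩

/-- Lemma R in Mathlib's domination order on `LocalSubring K`. -/
theorem exists_valuationSubring_le_chain (R : ℕ → LocalSubring K)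
    (hdom : ∀ i, R i ≤ R (i + 1)) :
    ∃ W : ValuationSubring K, ∀ i, R i ≤ W.toLocalSubring := by
  have hdom' : ∀ i, SubringDominates (R i).toSubring (R (i + 1)).toSubring := by
    intro i
    haveI := (R i).isLocalRing
    haveI := (R (i + 1)).isLocalRing
    exact (subringDominates_iff _ _).mpr (hdom i)
  obtain ⟨W, hW⟩ := exists_valuationSubring_dominates_chain (fun i => (R i).toSubring)
    (fun i => (R i).isLocalRing) hdom'
  refine ⟨W, fun i => ?_⟩
  haveI := (R i).isLocalRing
  haveI : IsLocalRing W.toSubring := W.toLocalSubring.isLocalRing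
  exact (subringDominates_iff _ _).mp (hW i)

/-- Contrapositive ("no infinite branch escapes every valuation"): there is no chain of local
subrings, each dominated by the next, such that every valuation subring fails to dominate some
member. This is how a valuation-indexed termination theorem is transferred to point-chosen
branches. -/
theorem not_forall_valuationSubring_exists_not_dominates (R : ℕ → Subring K)
    (hloc : ∀ i, IsLocalRing (R i)) (hdom : ∀ i, SubringDominates (R i) (R (i + 1))) :
    ¬ ∀ W : ValuationSubring K, ∃ i, ¬ SubringDominates (R i) W.toSubring := by
  intro h
  obtain ⟨W, hW⟩ := exists_valuationSubring_dominates_chain R hloc hdom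
  obtain ⟨i, hi⟩ := h W
  exact hi (hW i)

end Summit.ResolutionOfSingularities.ResolutionOfSingularities.Theorems

end
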